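import Summits.MatrixMultiplication.OmegaCensus.STPP222IcosetWSearchPrims

/-!
# ω-census, icoset class negatives at 2-rank four: semantics of the witness-model engine, III (the `𝔽₂`-linear system)

HONEST FRAMING (pub-omega census; verbatim): lottery ticket; floor = certified bounds/negative ranges.
Census STRUCTURE bookkeeping (Q7, the involution-coset class), nothing about `ω`.

Semantics of the offset equations of `STPP222IcosetWSearch.lean`: a bit solution `BSol` (frames `sA sB sC` and offsets `p q`, 4-bit
values per triple) valuates column `8t + e` by bit `e` of `p_t` and column `8t + 4 + e` by bit `e` of `q_t`; a row `r` (coefficients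
below bit `RB = 8K`, right-hand side at bit `RB`) has VALUE `⟨coeffs, valuation⟩ + rhs` over `𝔽₂` (`rowVal`) and is SATISFIED when the
value is `0`.  Proved: the value is additive under `xor` of rows (`rowVal_xor`); `reduceRow` by satisfied rows preserves the value;
**`addEq_sound`**: adding a satisfied equation to a satisfied reduced system never answers INCONSISTENT and yields a satisfied system;
**`rowVal_eqRow`**: the engine's equation row of witness `u` for the zero `(i,j,k)` is satisfied iff `u(p_i + q_j + p_k + q_k) = 1`.
Seat pub-omega-kernel-l4 (gen 20), 2026-08-27.
-/

namespace Summit.MatrixMultiplication.OmegaCensus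

namespace IcosetW

open IcosetH (getI snoc allN allN_true snoc_eq)

/-! ## Boolean folds -/

/-- `xor` of `f 0, …, f (n-1)`. -/
def bfold (n : ℕ) (f : ℕ → Bool) : Bool := @Nat.rec (fun _ => Bool) false (fun m acc => xor acc (f m)) n

/-- The empty fold. -/
@[simp] theorem bfold_zero (f : ℕ → Bool) : bfold 0 f = false := rfl
/-- One more term. -/
theorem bfold_succ (n : ℕ) (f : ℕ → Bool) : bfold (n + 1) f = xor (bfold n f) (f n) := rfl

/-- Pointwise `xor` comes out of the fold. -/
theorem bfold_xor (n : ℕ) (f g : ℕ → Bool) : bfold n (fun m => xor (f m) (g m)) = xor (bfold n f) (bfold n g) := by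
  induction n with
  | zero => rfl
  | succ n ih => rw [bfold_succ, bfold_succ, bfold_succ, ih]; cases bfold n f <;> cases bfold n g <;> cases f n <;> cases g n <;> rfl

/-- A fold of `false`s is `false`. -/
theorem bfold_false {n : ℕ} {f : ℕ → Bool} (h : ∀ m, m < n → f m = false) : bfold n f = false := by
  induction n with
  | zero => rfl
  | succ n ih => rw [bfold_succ, ih fun m hm => h m (Nat.lt_succ_of_lt hm), h n (Nat.lt_succ_self n)]; rfl

/-- Splitting a fold. -/
theorem bfold_add (a b : ℕ) (f : ℕ → Bool) : bfold (a + b) f = xor (bfold a f) (bfold b fun m => f (a + m)) := by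
  induction b with
  | zero => simp
  | succ b ih => rw [Nat.add_succ, bfold_succ, ih, bfold_succ, Bool.xor_assoc]

/-- Pointwise equal functions below `n` have equal folds. -/
theorem bfold_congr {n : ℕ} {f g : ℕ → Bool} (h : ∀ m, m < n → f m = g m) : bfold n f = bfold n g := by
  induction n with
  | zero => rfl
  | succ n ih => rw [bfold_succ, bfold_succ, ih fun m hm => h m (Nat.lt_succ_of_lt hm), h n (Nat.lt_succ_self n)]

/-! ## Bit solutions, valuation, row values -/

/-- A candidate icoset datum of `𝔽₂⁴ × H` in bits: frames and the two offsets `p_t = xA_t + xB_t`, `q_t = xB_t + xC_t`. -/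
structure BSol where
  /-- first frame vector -/ sA : ℕ → ℕ
  /-- second frame vector -/ sB : ℕ → ℕ
  /-- third frame vector -/ sC : ℕ → ℕ
  /-- offset `p` -/ p : ℕ → ℕ
  /-- offset `q` -/ q : ℕ → ℕ

namespace BSol

variable (S : BSol)

/-- The valuation of the unknown columns: column `8t + e` (`e < 4`) is bit `e` of `p_t`, column `8t + 4 + e` is bit `e` of `q_t`. -/
def w (m : ℕ) : Bool := if m % 8 < 4 then Nat.testBit (S.p (m / 8)) (m % 8) else Nat.testBit (S.q (m / 8)) (m % 8 - 4)

/-- Value of the affine row `r` (coefficients below `RB`, right-hand side at bit `RB`) at the solution: `⟨r, w⟩ + rhs`. -/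
def rowVal (RB r : ℕ) : Bool := xor (bfold RB fun m => Nat.testBit r m && S.w m) (Nat.testBit r RB)

/-- The offset of the zero `(i, j, k)`: `p_i + q_j + p_k + q_k`. -/
def off (i j k : ℕ) : ℕ := Nat.xor (Nat.xor (S.p i) (S.q j)) (Nat.xor (S.p k) (S.q k))

/-- Row values are additive. -/
theorem rowVal_xor (RB r₁ r₂ : ℕ) : S.rowVal RB (Nat.xor r₁ r₂) = xor (S.rowVal RB r₁) (S.rowVal RB r₂) := by
  unfold rowVal
  have e : (fun m => Nat.testBit (Nat.xor r₁ r₂) m && S.w m) =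
      fun m => xor (Nat.testBit r₁ m && S.w m) (Nat.testBit r₂ m && S.w m) := by
    funext m; show ((r₁ ^^^ r₂).testBit m && S.w m) = _; rw [Nat.testBit_xor]
    cases Nat.testBit r₁ m <;> cases Nat.testBit r₂ m <;> cases S.w m <;> rfl
  rw [e, bfold_xor, show Nat.testBit (Nat.xor r₁ r₂) RB = xor (Nat.testBit r₁ RB) (Nat.testBit r₂ RB) from Nat.testBit_xor _ _ _]
  cases bfold RB (fun m => Nat.testBit r₁ m && S.w m) <;> cases bfold RB (fun m => Nat.testBit r₂ m && S.w m) <;>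
    cases Nat.testBit r₁ RB <;> cases Nat.testBit r₂ RB <;> rfl

/-! ## Reduction and `addEq` -/

/-- One step of `reduceRow`. -/
theorem reduceRow_cons (x : ℕ) (R : List ℕ) (cmask r : ℕ) : reduceRow (x :: R) cmask r =
    reduceRow R cmask (cnd (Nat.beq (Nat.land r (lowBit (Nat.land x cmask))) 0) r (Nat.xor r x)) := by
  show frc (cnd (Nat.beq (Nat.land r (lowBit (Nat.land x cmask))) 0) r (Nat.xor r x)) (fun r' => reduceRow R cmask r') = _
  rw [frc_eq]

/-- Reducing by SATISFIED rows keeps the value; rows below `2^(RB+1)` keep the reduced row below `2^(RB+1)`. -/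
theorem reduceRow_spec (RB cmask : ℕ) : ∀ (R : List ℕ) (r : ℕ), (∀ x ∈ R, S.rowVal RB x = false ∧ x < 2 ^ (RB + 1)) →
    r < 2 ^ (RB + 1) → S.rowVal RB (reduceRow R cmask r) = S.rowVal RB r ∧ reduceRow R cmask r < 2 ^ (RB + 1) := by
  intro R
  induction R with
  | nil => intro r _ hr; exact ⟨rfl, hr⟩
  | cons x R ih =>
    intro r hR hr
    rw [reduceRow_cons, cnd_eq_ite]
    have hx := hR x List.mem_cons_self
    have hR' : ∀ y ∈ R, S.rowVal RB y = false ∧ y < 2 ^ (RB + 1) := fun y hy => hR y (List.mem_cons_of_mem _ hy)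
    split_ifs
    · exact ih r hR' hr
    · obtain ⟨h1, h2⟩ := ih (Nat.xor r x) hR' (Nat.xor_lt_two_pow hr hx.2)
      exact ⟨by rw [h1, rowVal_xor, hx.1, Bool.xor_false], h2⟩

/-- A row below `2^(RB+1)` with no coefficient bits and value `false` is `0`. -/
theorem eq_zero_of_noCoeff {RB r : ℕ} (hr : r < 2 ^ (RB + 1)) (hc : Nat.land r (Nat.sub (bit RB) 1) = 0)
    (hv : S.rowVal RB r = false) : r = 0 := by
  have hmod : r % 2 ^ RB = 0 := by
    rw [← hc, bit_eq]; exact (Nat.and_two_pow_sub_one_eq_mod r RB).symm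
  have hbits : ∀ m, m < RB → Nat.testBit r m = false := by
    intro m hm
    have : Nat.testBit (r % 2 ^ RB) m = Nat.testBit r m := by rw [Nat.testBit_mod_two_pow]; simp [hm]
    rw [← this, hmod, Nat.zero_testBit]
  unfold rowVal at hv
  rw [bfold_false fun m hm => by rw [hbits m hm]; rfl, Bool.false_xor] at hv
  apply Nat.eq_of_testBit_eq
  intro m
  rw [Nat.zero_testBit]
  rcases lt_trichotomy m RB with h | rfl | h
  · exact hbits m h
  · exact hv
  · exact Nat.testBit_eq_false_of_lt (lt_of_lt_of_le hr (Nat.pow_le_pow_right (by norm_num) h))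

/-- **`addEq` soundness.**  If the stored rows are satisfied (and below `2^(RB+1)`) and the new equation `row · x = 1` holds
(`rowVal (row ||| bit RB) = false`, `row < 2^RB`), then `addEq` returns `0 :: R'` with `R'` satisfied and below `2^(RB+1)`. -/
theorem addEq_sound {RB : ℕ} {R : List ℕ} {row : ℕ} (hR : ∀ x ∈ R, S.rowVal RB x = false ∧ x < 2 ^ (RB + 1))
    (hrow : row < 2 ^ RB) (hsat : S.rowVal RB (Nat.lor row (bit RB)) = false) :
    ∃ R', addEq R RB row = 0 :: R' ∧ ∀ x ∈ R', S.rowVal RB x = false ∧ x < 2 ^ (RB + 1) := by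
  have hlt : Nat.lor row (bit RB) < 2 ^ (RB + 1) := by
    rw [bit_eq]
    exact Nat.or_lt_two_pow (lt_of_lt_of_le hrow (Nat.pow_le_pow_right (by norm_num) (Nat.le_succ _)))
      (Nat.pow_lt_pow_right (by norm_num) (Nat.lt_succ_self _))
  obtain ⟨hv, hb⟩ := S.reduceRow_spec RB (Nat.sub (bit RB) 1) R _ hR hlt
  rw [hsat] at hv
  unfold addEq
  simp only [frc_eq, cnd_eq_ite, Nat.beq_eq]
  split_ifs with hc hz
  · exact ⟨R, rfl, hR⟩
  · exact absurd (S.eq_zero_of_noCoeff hb hc hv) hz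
  · refine ⟨snoc R _, rfl, fun x hx => ?_⟩
    rw [snoc_eq, List.mem_append, List.mem_singleton] at hx
    rcases hx with hx | rfl
    · exact hR x hx
    · exact ⟨hv, hb⟩

/-! ## The equation row of a witness -/

/-- Kernel evaluation: `par4` is the fold of the four low bits, and `ev` is additive in the vector. -/
theorem par4_ev_check : (allN 16 fun x => par4 x == bfold 4 fun e => Nat.testBit x e) = true ∧
    (allN 16 fun u => allN 16 fun a => allN 16 fun b => ev u (Nat.xor a b) == xor (ev u a) (ev u b)) = true ∧
    (allN 16 fun x => Nat.beq x ((cnd (Nat.testBit x 0) 1 0) + (cnd (Nat.testBit x 1) 2 0) + (cnd (Nat.testBit x 2) 4 0) +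
      (cnd (Nat.testBit x 3) 8 0))) = true := by
  refine ⟨?_, ?_, ?_⟩ <;> decide +kernel

/-- `par4 x` is the `xor` of the four low bits of `x < 16`. -/
theorem par4_eq {x : ℕ} (hx : x < 16) : par4 x = bfold 4 fun e => Nat.testBit x e :=
  eq_of_beq (allN_true par4_ev_check.1 hx)

/-- `ev` is additive in the vector. -/
theorem ev_xor {u a b : ℕ} (hu : u < 16) (ha : a < 16) (hb : b < 16) : ev u (Nat.xor a b) = xor (ev u a) (ev u b) :=
  eq_of_beq (allN_true (allN_true (allN_true par4_ev_check.2.1 hu) ha) hb)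

/-- A number below `16` is the sum of its four bits. -/
theorem eq_sum_bits {x : ℕ} (hx : x < 16) :
    x = (cnd (Nat.testBit x 0) 1 0) + (cnd (Nat.testBit x 1) 2 0) + (cnd (Nat.testBit x 2) 4 0) + (cnd (Nat.testBit x 3) 8 0) :=
  Nat.eq_of_beq_eq_true (allN_true par4_ev_check.2.2 hx)

/-- The 4-bit number read off the valuation at columns `s … s+3`. -/
noncomputable def val (s : ℕ) : ℕ := (cnd (S.w s) 1 0) + (cnd (S.w (s + 1)) 2 0) + (cnd (S.w (s + 2)) 4 0) + (cnd (S.w (s + 3)) 8 0)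

/-- Bits of `val`. -/
theorem val_spec (s : ℕ) : S.val s < 16 ∧ ∀ e, e < 4 → Nat.testBit (S.val s) e = S.w (s + e) := by
  unfold val
  have key : ∀ b0 b1 b2 b3 : Bool, (cnd b0 1 0 + cnd b1 2 0 + cnd b2 4 0 + cnd b3 8 0 < 16) ∧
      Nat.testBit (cnd b0 1 0 + cnd b1 2 0 + cnd b2 4 0 + cnd b3 8 0) 0 = b0 ∧
      Nat.testBit (cnd b0 1 0 + cnd b1 2 0 + cnd b2 4 0 + cnd b3 8 0) 1 = b1 ∧
      Nat.testBit (cnd b0 1 0 + cnd b1 2 0 + cnd b2 4 0 + cnd b3 8 0) 2 = b2 ∧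
      Nat.testBit (cnd b0 1 0 + cnd b1 2 0 + cnd b2 4 0 + cnd b3 8 0) 3 = b3 := by decide
  obtain ⟨hlt, h0, h1, h2, h3⟩ := key (S.w s) (S.w (s + 1)) (S.w (s + 2)) (S.w (s + 3))
  refine ⟨hlt, fun e he => ?_⟩
  interval_cases e
  · simpa using h0
  · exact h1
  · exact h2
  · exact h3

/-- `ev u v` as the fold of `testBit u e && testBit v e`. -/
theorem ev_eq_bfold {u v : ℕ} (hu : u < 16) : ev u v = bfold 4 fun e => Nat.testBit u e && Nat.testBit v e := by
  unfold ev
  rw [par4_eq (x := Nat.land u v) (lt_of_le_of_lt Nat.and_le_left hu)]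
  exact bfold_congr fun e _ => by show (u &&& v).testBit e = _; rw [Nat.testBit_and]

/-- **Block lemma.**  The fold of a shifted 4-bit coefficient block against the valuation is `ev u (val s)`. -/
theorem bfold_block {RB u s : ℕ} (hu : u < 16) (hs : s + 4 ≤ RB) :
    bfold RB (fun m => Nat.testBit (Nat.shiftLeft u s) m && S.w m) = ev u (S.val s) := by
  obtain ⟨hvlt, hvb⟩ := S.val_spec s
  rw [ev_eq_bfold hu]
  obtain ⟨d, hd⟩ : ∃ d, RB = s + 4 + d := ⟨RB - (s + 4), by omega⟩
  rw [hd, bfold_add, bfold_add]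
  have tb : ∀ m, Nat.testBit (Nat.shiftLeft u s) m = (decide (m ≥ s) && Nat.testBit u (m - s)) := fun m => by
    show (u <<< s).testBit m = _; rw [Nat.testBit_shiftLeft]
  have lo : bfold s (fun m => Nat.testBit (Nat.shiftLeft u s) m && S.w m) = false :=
    bfold_false fun m hm => by rw [tb]; simp [Nat.not_le.2 hm]
  have hi : bfold d (fun m => Nat.testBit (Nat.shiftLeft u s) (s + 4 + m) && S.w (s + 4 + m)) = false :=
    bfold_false fun m _ => by
      have hu' : u < 2 ^ (4 + m) := lt_of_lt_of_le hu (Nat.pow_le_pow_right (by norm_num : 0 < 2) (by omega : 4 ≤ 4 + m))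
      rw [tb, show s + 4 + m - s = 4 + m by omega, Nat.testBit_eq_false_of_lt hu']
      simp
  rw [lo, hi, Bool.false_xor, Bool.xor_false]
  exact bfold_congr fun e he => by rw [tb, show s + e - s = e by omega, hvb e he]; simp

/-- `val (8t) = p_t` and `val (8t + 4) = q_t` for 4-bit offsets. -/
theorem val_eq (t : ℕ) (hp : S.p t < 16) (hq : S.q t < 16) : S.val (8 * t) = S.p t ∧ S.val (8 * t + 4) = S.q t := by
  have wp : ∀ e, e < 4 → S.w (8 * t + e) = Nat.testBit (S.p t) e := fun e he => by
    unfold w; rw [show (8 * t + e) % 8 = e by omega, if_pos he, show (8 * t + e) / 8 = t by omega]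
  have wq : ∀ e, e < 4 → S.w (8 * t + 4 + e) = Nat.testBit (S.q t) e := fun e he => by
    unfold w
    rw [show (8 * t + 4 + e) % 8 = 4 + e by omega, if_neg (by omega), show (8 * t + 4 + e) / 8 = t by omega,
      show 4 + e - 4 = e by omega]
  constructor
  · unfold val
    rw [show 8 * t = 8 * t + 0 from rfl, wp 0 (by norm_num), Nat.add_zero, wp 1 (by norm_num), wp 2 (by norm_num),
      wp 3 (by norm_num)]
    exact (eq_sum_bits hp).symm
  · unfold val
    rw [show 8 * t + 4 = 8 * t + 4 + 0 from rfl, wq 0 (by norm_num), Nat.add_zero, wq 1 (by norm_num), wq 2 (by norm_num),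
      wq 3 (by norm_num)]
    exact (eq_sum_bits hq).symm

/-- **The witness equation.**  For a zero `(i, j, k)` with indices `< K` and witness `u < 16`, the engine's row with right-hand side
`1` is satisfied iff `u(p_i + q_j + p_k + q_k) = 1`. -/
theorem rowVal_eqRow {K u i j k : ℕ} (hu : u < 16) (hi : i < K) (hj : j < K) (hk : k < K)
    (hp : ∀ t, t < K → S.p t < 16 ∧ S.q t < 16) :
    S.rowVal (8 * K) (Nat.lor (eqRow u i j k) (bit (8 * K))) = !(ev u (S.off i j k)) ∧ eqRow u i j k < 2 ^ (8 * K) := by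
  have hsh : ∀ s, s + 4 ≤ 8 * K → Nat.shiftLeft u s < 2 ^ (8 * K) := fun s hs => by
    show u <<< s < _; rw [Nat.shiftLeft_eq]
    calc u * 2 ^ s < 16 * 2 ^ s := Nat.mul_lt_mul_of_pos_right hu (Nat.two_pow_pos s)
      _ = 2 ^ (s + 4) := by rw [pow_add]; norm_num; ring
      _ ≤ 2 ^ (8 * K) := Nat.pow_le_pow_right (by norm_num) hs
  have hrow : eqRow u i j k < 2 ^ (8 * K) := by
    unfold eqRow
    exact Nat.xor_lt_two_pow
      (Nat.xor_lt_two_pow (hsh _ (by show 8 * i + 4 ≤ 8 * K; omega)) (hsh _ (by show 8 * j + 4 + 4 ≤ 8 * K; omega)))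
      (Nat.xor_lt_two_pow (hsh _ (by show 8 * k + 4 ≤ 8 * K; omega)) (hsh _ (by show 8 * k + 4 + 4 ≤ 8 * K; omega)))
  refine ⟨?_, hrow⟩
  -- the right-hand side bit and the coefficient part
  have hcoef : (bfold (8 * K) fun m => Nat.testBit (Nat.lor (eqRow u i j k) (bit (8 * K))) m && S.w m) =
      bfold (8 * K) fun m => Nat.testBit (eqRow u i j k) m && S.w m :=
    bfold_congr fun m hm => by
      show ((eqRow u i j k ||| bit (8 * K)).testBit m && S.w m) = _
      rw [Nat.testBit_or, bit_eq, Nat.testBit_two_pow]; simp [Nat.ne_of_gt hm]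
  have hrhs : Nat.testBit (Nat.lor (eqRow u i j k) (bit (8 * K))) (8 * K) = true := by
    show (eqRow u i j k ||| bit (8 * K)).testBit (8 * K) = true
    rw [Nat.testBit_or, bit_eq, Nat.testBit_two_pow_self]; simp
  unfold rowVal; rw [hcoef, hrhs]
  -- split the four blocks
  have hE : (bfold (8 * K) fun m => Nat.testBit (eqRow u i j k) m && S.w m) = ev u (S.off i j k) := by
    have e4 : (fun m => Nat.testBit (eqRow u i j k) m && S.w m) = fun m =>
        xor (xor (Nat.testBit (Nat.shiftLeft u (Nat.mul 8 i)) m && S.w m)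
          (Nat.testBit (Nat.shiftLeft u (Nat.add (Nat.mul 8 j) 4)) m && S.w m))
          (xor (Nat.testBit (Nat.shiftLeft u (Nat.mul 8 k)) m && S.w m)
            (Nat.testBit (Nat.shiftLeft u (Nat.add (Nat.mul 8 k) 4)) m && S.w m)) := by
      funext m; unfold eqRow
      show ((((u <<< (8 * i)) ^^^ (u <<< (8 * j + 4))) ^^^ ((u <<< (8 * k)) ^^^ (u <<< (8 * k + 4)))).testBit m && S.w m) = _
      rw [Nat.testBit_xor, Nat.testBit_xor, Nat.testBit_xor]
      cases (u <<< (8 * i)).testBit m <;> cases (u <<< (8 * j + 4)).testBit m <;> cases (u <<< (8 * k)).testBit m <;>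
        cases (u <<< (8 * k + 4)).testBit m <;> cases S.w m <;> rfl
    rw [e4, bfold_xor, bfold_xor, bfold_xor]
    rw [show Nat.add (Nat.mul 8 j) 4 = 8 * j + 4 from rfl, show Nat.add (Nat.mul 8 k) 4 = 8 * k + 4 from rfl,
      show Nat.mul 8 i = 8 * i from rfl, show Nat.mul 8 k = 8 * k from rfl,
      S.bfold_block hu (by omega), S.bfold_block hu (by omega), S.bfold_block hu (by omega), S.bfold_block hu (by omega),
      (S.val_eq i (hp i hi).1 (hp i hi).2).1, (S.val_eq j (hp j hj).1 (hp j hj).2).2, (S.val_eq k (hp k hk).1 (hp k hk).2).1,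
      (S.val_eq k (hp k hk).1 (hp k hk).2).2]
    unfold off
    have b1 := (hp i hi).1; have b2 := (hp j hj).2; have b3 := (hp k hk).1; have b4 := (hp k hk).2
    rw [ev_xor (a := Nat.xor (S.p i) (S.q j)) (b := Nat.xor (S.p k) (S.q k)) hu (Nat.xor_lt_two_pow (n := 4) b1 b2)
      (Nat.xor_lt_two_pow (n := 4) b3 b4), ev_xor hu b1 b2, ev_xor hu b3 b4]
  rw [hE]; cases ev u (S.off i j k) <;> rfl

end BSol

end IcosetW

end Summit.MatrixMultiplication.OmegaCensus
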